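import Mathlib.FieldTheory.Finite.Basic
import Mathlib.Tactic.IntervalCases
import HarnessLib

/-!
# The unit character sum `Σ_μ μ^{s−r}` and the extraction `Σ_μ μ^{−r} Σ_s μ^s P_s = −P_r` (instrument, NOT a resolution theorem)

Engine 1 of the RESOLUTION OBSERVATORY toy model `W(f)` (weighted-centre invariant in characteristic `p`; RE-DERIVATION-eng1-g41
§3.7 "the GROUP TRICK", LEMMA C; CARVER-NOTES-eng1-g41 T90) averages an isotropy over the base changes `σ ↦ μσ`, `μ ∈ 𝔽_p^×`,
and extracts one `σ`-degree with the character identity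

  `Σ_{μ ∈ K^×} μ^m = −1` if `(q − 1) ∣ m`, `= 0` otherwise (`q = #K`; Mathlib: `FiniteField.sum_pow_units`),

in the form: for components `P_s` (`1 ≤ s ≤ q`) in a `K`-module and `2 ≤ r ≤ q − 1`,
`Σ_μ μ^{−r} • Σ_{s=1}^{q} μ^s • P_s = −P_r` ("the only `s ∈ [1, q]` with `s ≡ r (mod q − 1)` is `r`").  This file types exactly that
(pure finite-field algebra, no model notions):

* `CharacterSum.dvd_pred_card_iff` — for `s ∈ [1, q]`, `2 ≤ r ≤ q − 1`: `(q−1) ∣ (q−1−r+s) ↔ s = r` (the exponent bookkeeping, with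
  `μ^{−r} = μ^{q−1−r}`);
* `CharacterSum.sum_units_inv_pow_mul_pow` — `Σ_μ (μ⁻¹)^r μ^s = [ (q−1) ∣ (q−1−r+s) ] · (−1)`;
* `CharacterSum.sum_units_inv_pow_smul_sum_pow_smul` — the extraction identity over any finite field `K` and `K`-module;
* `CharacterSum.zmod_sum_units_inv_pow_smul_sum_pow_smul` — the engine's instance `K = ZMod p`, `q = p`.

References: [Lang2002, Ch. V §5 (finite fields: the unit group is cyclic of order `q − 1`)]; Mathlib `FiniteField.sum_pow_units`.
The packaging for the toy model is OURS; nothing here is a statement about resolution of singularities.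
-/

namespace Literature.AlgebraicGeometry.Resolution.WeightedBlowup

namespace CharacterSum

/-- Exponent bookkeeping (ours): for `1 ≤ s ≤ q` and `2 ≤ r ≤ q − 1`, `(q − 1) ∣ (q − 1 − r + s) ↔ s = r`.
[cite: Lang2002, Ch. V §5] -/
theorem dvd_pred_card_iff {q r s : ℕ} (hr : 2 ≤ r) (hrq : r ≤ q - 1) (hs1 : 1 ≤ s) (hsq : s ≤ q) :
    (q - 1) ∣ (q - 1 - r + s) ↔ s = r := by
  constructor
  · rintro ⟨m, hm⟩
    rcases Nat.lt_or_ge m 2 with hm2 | hm2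
    · interval_cases m <;> omega
    · have h2 : (q - 1) * 2 ≤ (q - 1) * m := Nat.mul_le_mul_left _ hm2
      omega
  · rintro rfl
    exact ⟨1, by omega⟩

variable {K : Type*} [Field K] [Fintype K] [DecidableEq K]

/-- The unit character sum with an inverse power (ours, from `FiniteField.sum_pow_units`): for `r ≤ q − 1`,
`Σ_{μ ∈ Kˣ} (μ⁻¹)^r μ^s = −1` if `(q−1) ∣ (q−1−r+s)` and `0` otherwise. [cite: Lang2002, Ch. V §5] -/
theorem sum_units_inv_pow_mul_pow (r s : ℕ) (hr : r ≤ Fintype.card K - 1) :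
    ∑ μ : Kˣ, ((μ⁻¹ : Kˣ) : K) ^ r * (μ : K) ^ s
      = if (Fintype.card K - 1) ∣ (Fintype.card K - 1 - r + s) then -1 else 0 := by
  rw [← FiniteField.sum_pow_units]
  refine Finset.sum_congr rfl fun μ _ => ?_
  have hq : (μ : K) ^ (Fintype.card K - 1) = 1 := FiniteField.pow_card_sub_one_eq_one _ μ.ne_zero
  have e : ((μ⁻¹ : Kˣ) : K) ^ r = (μ : K) ^ (Fintype.card K - 1 - r) := by
    rw [Units.val_inv_eq_inv_val, inv_pow]
    refine inv_eq_of_mul_eq_one_left ?_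
    rw [← pow_add, Nat.sub_add_cancel hr, hq]
  rw [e, ← pow_add]

/-- **The extraction identity** (ours; engine 1's use of LEMMA C): for `P : ℕ → M` into a `K`-module and `2 ≤ r ≤ q − 1`,
`Σ_{μ ∈ Kˣ} (μ⁻¹)^r • Σ_{s = 1}^{q} μ^s • P s = −P r`. [cite: Lang2002, Ch. V §5] -/
theorem sum_units_inv_pow_smul_sum_pow_smul {M : Type*} [AddCommGroup M] [Module K M] (P : ℕ → M) {r : ℕ} (hr : 2 ≤ r)
    (hrq : r ≤ Fintype.card K - 1) :
    ∑ μ : Kˣ, ((μ⁻¹ : Kˣ) : K) ^ r • ∑ s ∈ Finset.Icc 1 (Fintype.card K), (μ : K) ^ s • P s = -P r := by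
  simp_rw [Finset.smul_sum, smul_smul]
  rw [Finset.sum_comm]
  simp_rw [← Finset.sum_smul]
  rw [Finset.sum_eq_single r]
  · rw [sum_units_inv_pow_mul_pow r r hrq, if_pos ⟨1, by omega⟩, neg_one_smul]
  · intro s hs hsr
    rw [Finset.mem_Icc] at hs
    rw [sum_units_inv_pow_mul_pow r s hrq, if_neg fun h => hsr ((dvd_pred_card_iff hr hrq hs.1 hs.2).mp h), zero_smul]
  · intro h
    exact absurd (Finset.mem_Icc.mpr ⟨by omega, by omega⟩) h

/-- The engine's instance `K = ZMod p` (`q = p`; ours): for an `𝔽_p`-module `M`, `P : ℕ → M` and `2 ≤ r ≤ p − 1`,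
`Σ_{μ ∈ 𝔽_pˣ} μ^{−r} • Σ_{s=1}^{p} μ^s • P s = −P r`. [cite: Lang2002, Ch. V §5] -/
theorem zmod_sum_units_inv_pow_smul_sum_pow_smul (p : ℕ) [Fact p.Prime] {M : Type*} [AddCommGroup M] [Module (ZMod p) M]
    (P : ℕ → M) {r : ℕ} (hr : 2 ≤ r) (hrp : r ≤ p - 1) :
    ∑ μ : (ZMod p)ˣ, ((μ⁻¹ : (ZMod p)ˣ) : ZMod p) ^ r • ∑ s ∈ Finset.Icc 1 p, (μ : ZMod p) ^ s • P s = -P r := by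
  have h := sum_units_inv_pow_smul_sum_pow_smul (K := ZMod p) P hr (by rwa [ZMod.card])
  rwa [ZMod.card] at h

/-- Smoke test (ours): in `𝔽_3`, `Σ_μ μ² = 1 + 1 = −1` and `Σ_μ μ = 0`. [cite: Lang2002, Ch. V §5] -/
example : (∑ μ : (ZMod 3)ˣ, ((μ : ZMod 3) ^ 2) = -1) ∧ (∑ μ : (ZMod 3)ˣ, ((μ : ZMod 3) ^ 1) = 0) := by
  constructor <;> decide

end CharacterSum

end Literature.AlgebraicGeometry.Resolution.WeightedBlowup
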